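import Literature.NumberTheory.EllipticCurves.TateNormalFormUnramifiedClassesProofs
import Literature.NumberTheory.EllipticCurves.NodeReductionGaloisProofs
import Literature.NumberTheory.EllipticCurves.ReductionHomomorphismSurjectiveProofs
import Literature.NumberTheory.EllipticCurves.UnramifiedCoboundaryInputs
import Literature.NumberTheory.EllipticCurves.GaloisAction
import HarnessLib

/-!
# Norms from the unramified layer onto `E₀(K_v)` for the Tate normal form (split multiplicative
# reduction): the surjectivity half of Mazur's `H¹(G₀, E(L)) ≅ H¹(G₀, E(L)/E₀(L))`

`Proofs` file (theorems only, no definitions, no named facts) in topic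
`NumberTheory/EllipticCurves`, a bottom-up step of the discharge of
`Literature.Barriers.BirchSwinnertonDyer.Matsuno2009_lemma41_local` (K. Matsuno, Math. Res. Lett.
16 (2009), Lemma 4.1, local half of the printed proof, p. 454: "(4) `H¹(G₀, E(L)) ≅
H¹(G₀, E(L)/E₀(L))` (cf. [21, Proposition 4.3])", [21] = B. Mazur, *Rational points of abelian
varieties with values in towers of number fields*, Invent. Math. 18 (1972), Prop. 4.3; for the
cyclic group `G₀ = Gal(L/ℚ_ℓ)` of the unramified extension `L` the surjectivity of (4) amounts to
the vanishing of `Ĥ⁰(G₀, E₀(L)) = E₀(ℚ_ℓ)/N_{G₀} E₀(L)`, i.e. **every point of `E₀(ℚ_ℓ)` is a norm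
from `E₀(L)`** — Lang's theorem for the connected group `E₀` over the finite residue field
together with Hensel's lemma).

We prove this norm surjectivity for the **Tate normal form** `J : y² + xy = x³ + a₆`
(`a₆ ∈ 𝓂_v`) over `𝓞_v` (the `𝓞_v`-model of every split multiplicative minimal equation,
`SplitMultiplicativeNormalForm`) and the unramified layer `K_v(ζ)`, `ζ` a primitive
`(qⁿ - 1)`-th root of unity, **of degree `n` prime to the residue characteristic**
(`|n|_v = 1`) — the case needed for Lemma 4.1, where `n ∣ f` may be replaced by `f = n` and
`ℓ ∤ n`.  In the local language of the tree (`K_v`, `K̄_v` with `w = |·|_v`, `Γ = Γ_{K_v}`, the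
prime `𝔐`, an arithmetic Frobenius `F`, `q = #k_v`; `E₀ ⊆ J(K̄_v)` the points with
`ReducesToNonsingular |·|_v`, `KodairaNeronUnramified`):

* `exists_norm_eq_of_tateNormalForm` — for `S ∈ J(K̄_v)` fixed by `Γ` and lying in `E₀`
  there is `R₀ ∈ E₀`, fixed by every `σ ∈ Γ` with `σ ζ = ζ` (a point of `E₀(K_v(ζ))`), with
  `Σ_{j<n} Fʲ R₀ = S`.

## Proof (prime-to-`p` degree; no successive approximation)

Let `r : E₀(K̄_v) → k̄ˣ` be the reduction onto the split torus `Ẽ_ns(k̄) ≅ k̄ˣ`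
(`exists_addMonoidHom_units_of_map_eq_singularModel`, `NodeReductionMapProofs`, on the
`𝒪_w`-model `J ⊗ 𝒪_w`, whose reduction is `y² + xy = x³ = singularModel 0 0 0 (-1)`,
`TateNormalFormReductionProofs`), with kernel `E₁` and `r(P^σ) = σ̄ (r P)` for `σ ∈ Γ`
(`exists_residueMap_nodeReduction_smul`, `NodeReductionGaloisProofs`; the node is split since the
slopes `0 ≠ -1` are rational), `F̄ = (x ↦ x^q)`.  Then `s = r(S)` satisfies `s^q = s`.  As `k̄` is
algebraically closed there is `t` with `t^e = s`, `e = Σ_{j<n} qʲ`, and `t^{qⁿ-1} = s^{q-1} = 1`,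
so `t` is the residue of a power `η` of `ζ` (reduction is a bijection on `μ_{qⁿ-1}`,
`UnramifiedLayerRootsProofs`).  Lift `t` to a point of `E₀` (Hensel, `exists_equation_residue_eq`)
and correct it by a `(qⁿ - 1)`-division point of its `(qⁿ - 1)`-th multiple inside `E₁`
(`exists_zsmul_eq_of_one_lt_val`, `KernelReductionDivisibleProofs`) to a torsion point `R₁ ∈ E₀`
with `(qⁿ - 1) R₁ = O` and `r(R₁) = t`; such a point is fixed by every `σ` fixing `ζ` (its
conjugate has the same order and the same reduction `σ̄ t = t`, and `E₁` has no prime-to-`p`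
torsion, `ReducesToZero.eq_zero_of_zsmul_eq_zero`).  Now `r(Σ Fʲ R₁) = Π t^{qʲ} = t^e = s`, so
`D = S - Σ Fʲ R₁ ∈ E₁` is fixed by `F` and by the stabiliser of `ζ`; writing `D = n D'` with
`D' ∈ E₁` (`|n|_v = 1`), uniqueness of `D'` makes it fixed as well, whence `Σ Fʲ D' = n D' = D`
and `R₀ = R₁ + D'` is the required point.  (For `p ∣ n` one would need the trace/norm successive
approximation on the filtration of `E₁`, Serre, *Local Fields*, V §2; not needed here.)

## References

* [Matsuno2009] K. Matsuno, Math. Res. Lett. 16 (2009), 449–461, Lemma 4.1 (proof, p. 454).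
* [Mazur1972] B. Mazur, Invent. Math. 18 (1972), 183–266, Prop. 4.3.
* [SilvermanAEC2009] J. H. Silverman, *The Arithmetic of Elliptic Curves*, 2nd ed. (2009),
  VII.2.1–2.2, VII.3.1, III.2.5, Exercise 3.5(a).
* [SerreLocalFields1979] J.-P. Serre, *Local Fields* (1979), IV §4 Prop. 16, V §2, XIII §1.

## Design

No definitions; theorems only; `open scoped Classical NNReal`; one universe `u`; setting and
notation of `TateNormalFormUnramifiedClassesProofs` (file-local abbreviations `Kᵥ`, `𝓞ᵥ`, `K̄ᵥ`).
The Galois action on `J(K̄_v) = ((J ⊗ K_v) ⊗ K̄_v).Point` is written `σ • P` for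
`σ : K̄_v ≃ₐ[K_v] K̄_v` (the tree's `WeierstrassCurve.instDistribMulActionAlgEquivPoint`,
`GaloisAction`; `σ • P = Affine.Point.map ↑σ P` by `rfl`), applied to `toAlgEquiv τ`, `τ ∈ Γ`.
-/

noncomputable section

open scoped Classical NNReal
open NumberField IsDedekindDomain Field Polynomial IsLocalRing

universe u

namespace IsDedekindDomain.HeightOneSpectrum

open Literature.NumberTheory.EllipticCurves Literature.NumberTheory.GaloisRepresentations
  Literature.NumberTheory.GaloisRepresentations.IsNonarchimedeanLocalField WeierstrassCurve

variable {K : Type u} [Field K] [NumberField K] {v : HeightOneSpectrum (𝓞 K)}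
  {w : Valuation (AlgebraicClosure (v.adicCompletion K)) ℝ≥0}
  (hw : ∀ x, (w x : ℝ) = spectralNorm (v.adicCompletion K) (AlgebraicClosure (v.adicCompletion K)) x)

/-- `K_v`, file-local abbreviation. -/
local notation "Kᵥ" => IsDedekindDomain.HeightOneSpectrum.adicCompletion K v
/-- `𝓞_v`, file-local abbreviation. -/
local notation "𝓞ᵥ" => IsDedekindDomain.HeightOneSpectrum.adicCompletionIntegers K v
/-- `K̄_v`, file-local abbreviation. -/
local notation "K̄ᵥ" => AlgebraicClosure (IsDedekindDomain.HeightOneSpectrum.adicCompletion K v)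
/-- `q = #k_v`, file-local abbreviation. -/
local notation "qᵥ" => Nat.card (IsLocalRing.ResidueField
  (IsDedekindDomain.HeightOneSpectrum.adicCompletionIntegers K v))

/-! ## Residues in `𝒪_w`: congruences, roots of unity, Frobenius -/

section Residue

variable {L : Type u} [Field L] {w' : Valuation L ℝ≥0}

/-- Two `w`-integers have the same residue iff they are congruent modulo `𝔪_w`. [folklore] -/
theorem residue_integer_eq_iff (x y : w'.integer) :
    residue w'.integer x = residue w'.integer y ↔ w' ((x : L) - y) < 1 := by
  rw [← sub_eq_zero, ← map_sub, ← v_algebraMap_lt_one_iff (Valuation.integer.integers w')]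
  rfl

end Residue

include hw in
/-- **Reduction is injective on `μ_{qⁿ-1}`**: the residue in `𝒪_w/𝔪_w` of a primitive
`(qⁿ - 1)`-th root of unity of `K̄_v` is a primitive `(qⁿ - 1)`-th root of unity
(`eq_one_of_pow_eq_one_of_val_sub_lt_one`, `|qⁿ - 1|_v = 1`).  Serre, *Local Fields*, IV §4
Prop. 16. [cite: SerreLocalFields1979, Ch. IV §4 Prop. 16] -/
theorem isPrimitiveRoot_residue_integer {n : ℕ} (hn : n ≠ 0) {ζ : K̄ᵥ}
    (hζ : IsPrimitiveRoot ζ (qᵥ ^ n - 1)) (h1 : w ζ ≤ 1) :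
    IsPrimitiveRoot (residue w.integer ⟨ζ, h1⟩) (qᵥ ^ n - 1) := by
  have hm0 : qᵥ ^ n - 1 ≠ 0 := residueCard_pow_sub_one_ne_zero (v := v) hn
  have hmw : w ((qᵥ ^ n - 1 : ℕ) : K̄ᵥ) = 1 :=
    spectralValuation_natCast_residueCard_pow_sub_one hw hn
  rw [IsPrimitiveRoot.iff_def]
  refine ⟨?_, fun l hl ↦ ?_⟩
  · rw [← map_pow, ← map_one (residue w.integer)]
    congr 1
    exact Subtype.ext (by rw [SubmonoidClass.coe_pow]; exact hζ.pow_eq_one)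
  · have h2 : w ((((⟨ζ, h1⟩ : w.integer) ^ l : w.integer) : K̄ᵥ) - ((1 : w.integer) : K̄ᵥ)) < 1 := by
      rw [← residue_integer_eq_iff, map_pow, map_one]; exact hl
    rw [SubmonoidClass.coe_pow, OneMemClass.coe_one] at h2
    have h3 : (ζ ^ l) ^ (qᵥ ^ n - 1) = 1 := by
      rw [← pow_mul, mul_comm, pow_mul, hζ.pow_eq_one, one_pow]
    have h4 := eq_one_of_pow_eq_one_of_val_sub_lt_one w hm0 hmw h3 h2
    exact (hζ.pow_eq_one_iff_dvd l).mp h4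

include hw in
/-- **Teichmüller lifts in the layer**: every `(qⁿ - 1)`-th root of unity `t` of the residue
field `𝒪_w/𝔪_w` is the residue of a power of `ζ`.  Serre, *Local Fields*, II §4 Prop. 8.
[cite: SerreLocalFields1979, Ch. II §4 Prop. 8] -/
theorem exists_residue_pow_eq_of_pow_eq_one {n : ℕ} (hn : n ≠ 0) {ζ : K̄ᵥ}
    (hζ : IsPrimitiveRoot ζ (qᵥ ^ n - 1)) (h1 : w ζ ≤ 1)
    {t : IsLocalRing.ResidueField w.integer} (ht : t ^ (qᵥ ^ n - 1) = 1) :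
    ∃ i : ℕ, residue w.integer (⟨ζ, h1⟩ ^ i) = t := by
  haveI : NeZero (qᵥ ^ n - 1) := ⟨residueCard_pow_sub_one_ne_zero (v := v) hn⟩
  obtain ⟨i, -, hi⟩ := (isPrimitiveRoot_residue_integer hw hn hζ h1).eq_pow_of_pow_eq_one ht
  exact ⟨i, by rw [map_pow, hi]⟩

include hw in
/-- **The residue of `F z` is `z̄^q`** for an arithmetic Frobenius `F` at `𝔐` and `z ∈ 𝒪_w`
(`|F z - z^q|_v < 1`, `spectralValuation_frobenius_pow_sub_pow_lt_one`).  Neukirch, *ANT*, II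
(9.9). [folklore] -/
theorem residue_frobenius_smul_integer {𝔐 : Ideal v.localAbsIntegers} (h𝔐 : 𝔐 ∈ v.localPrimesAbove)
    {F : absoluteGaloisGroup Kᵥ} (hF : IsArithFrobAt 𝓞ᵥ F 𝔐) (z : w.integer)
    (h : w (absoluteGaloisGroup.toAlgEquiv Kᵥ F (z : K̄ᵥ)) ≤ 1) :
    residue w.integer ⟨absoluteGaloisGroup.toAlgEquiv Kᵥ F (z : K̄ᵥ), h⟩ =
      residue w.integer z ^ qᵥ := by
  have hlt := spectralValuation_frobenius_pow_sub_pow_lt_one hw h𝔐 hF 1 z.2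
  rw [pow_one, pow_one] at hlt
  rw [← map_pow, residue_integer_eq_iff, SubmonoidClass.coe_pow]
  exact hlt

include hw in
/-- Conjugates of the stabiliser of `ζ` by powers of the Frobenius stabilise `ζ`:
`(F⁻ʲ τ Fʲ) ζ = ζ` if `τ ζ = ζ` (`Fʲ ζ = ζ^{qʲ}`).  [folklore] -/
theorem frobenius_pow_inv_mul_mul_smul_eq {𝔐 : Ideal v.localAbsIntegers}
    (h𝔐 : 𝔐 ∈ v.localPrimesAbove) {F : absoluteGaloisGroup Kᵥ} (hF : IsArithFrobAt 𝓞ᵥ F 𝔐)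
    {n : ℕ} (hn : n ≠ 0) {ζ : K̄ᵥ} (hζ : IsPrimitiveRoot ζ (qᵥ ^ n - 1))
    {τ : absoluteGaloisGroup Kᵥ} (hτ : τ • ζ = ζ) (j : ℕ) :
    ((F ^ j)⁻¹ * τ * F ^ j) • ζ = ζ := by
  have hm0 : qᵥ ^ n - 1 ≠ 0 := residueCard_pow_sub_one_ne_zero (v := v) hn
  have hmw : w ((qᵥ ^ n - 1 : ℕ) : K̄ᵥ) = 1 :=
    spectralValuation_natCast_residueCard_pow_sub_one hw hn
  have hj : F ^ j • ζ = ζ ^ qᵥ ^ j :=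
    frobenius_pow_smul_eq_pow_of_pow_eq_one hw h𝔐 hF hm0 hmw hζ.pow_eq_one j
  rw [mul_smul, mul_smul, hj, smul_pow', hτ, ← hj, inv_smul_smul]

/-- `(Σ_{j<n} qʲ) (q - 1) = qⁿ - 1` in `ℕ` (`1 ≤ q`): Mathlib's `geom_sum_mul_of_one_le` (ordered
semirings with truncated subtraction cover `ℕ`); the name is kept as a deprecated alias (dedup-01054).
[folklore] -/
@[deprecated (since := "2026-08-16")]
alias geom_sum_mul_pred_eq := geom_sum_mul_of_one_le

/-! ## Norm surjectivity onto `E₀ ∩ J(K_v)` from the layer of degree `n`, `|n|_v = 1` -/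

include hw in
set_option maxHeartbeats 4000000 in
/-- **Every `Γ_{K_v}`-fixed point of `E₀` is a norm from `E₀(K_v(ζ))`** (the Tate normal form,
unramified layer of degree `n` with `|n|_v = 1`).  Let `J : y² + xy = x³ + a₆` (`a₆ ∈ 𝓂_v`) be a
Tate normal form over `𝓞_v` which is an elliptic curve over `K_v`, `F ∈ Γ_{K_v}` an arithmetic
Frobenius at `𝔐`, `n ≥ 1` with `|n|_v = 1`, `ζ ∈ K̄_v` a primitive `(qⁿ - 1)`-th root of unity.
For every point `S ∈ J(K̄_v)` fixed by `Γ_{K_v}` and with nonsingular reduction (`S ∈ E₀` for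
`|·|_v`) there is `R₀ ∈ E₀`, fixed by every `σ ∈ Γ_{K_v}` with `σ ζ = ζ`, such that
`Σ_{j<n} Fʲ R₀ = S`.  This is the vanishing of `Ĥ⁰(Gal(L/K_v), E₀(L))` for the unramified
extension `L = K_v(ζ)` (Mazur 1972, Prop. 4.3; the input (4) of Matsuno's proof of Lemma 4.1), in
the prime-to-`p` case, by the torsion argument described in the module docstring.
[cite: Matsuno2009, Lemma 4.1 (proof, p. 454, display (4))] -/
theorem exists_norm_eq_of_tateNormalForm (J : WeierstrassCurve 𝓞ᵥ) [(J.baseChange Kᵥ).IsElliptic]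
    (h1 : J.a₁ = 1) (h2 : J.a₂ = 0) (h3 : J.a₃ = 0) (h4 : J.a₄ = 0)
    (h6 : J.a₆ ∈ maximalIdeal 𝓞ᵥ)
    {𝔐 : Ideal v.localAbsIntegers} (h𝔐 : 𝔐 ∈ v.localPrimesAbove)
    {F : absoluteGaloisGroup Kᵥ} (hF : IsArithFrobAt 𝓞ᵥ F 𝔐)
    {n : ℕ} (hn : n ≠ 0) (hnw : w (n : K̄ᵥ) = 1)
    {ζ : K̄ᵥ} (hζ : IsPrimitiveRoot ζ (qᵥ ^ n - 1))
    (S : ((J.baseChange Kᵥ).baseChange K̄ᵥ).toAffine.Point)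
    (hS : ∀ σ : absoluteGaloisGroup Kᵥ, absoluteGaloisGroup.toAlgEquiv Kᵥ σ • S = S)
    (hS₀ : ReducesToNonsingular w (residue w.integer) S) :
    ∃ R₀ : ((J.baseChange Kᵥ).baseChange K̄ᵥ).toAffine.Point,
      ReducesToNonsingular w (residue w.integer) R₀ ∧
      (∀ σ : absoluteGaloisGroup Kᵥ, σ • ζ = ζ → absoluteGaloisGroup.toAlgEquiv Kᵥ σ • R₀ = R₀) ∧
      ∑ j ∈ Finset.range n, absoluteGaloisGroup.toAlgEquiv Kᵥ (F ^ j) • R₀ = S := by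
  /- (0) setting: the `𝒪_w`-model `W₀`, `E₀`, `E₁`, the node map `r` -/
  have hvw : w.Integers w.integer := Valuation.integer.integers w
  haveI : IsAlgClosed K̄ᵥ := inferInstance
  haveI hhens : HenselianRing w.integer (maximalIdeal w.integer) := henselianRing_integer w
  haveI hkac : IsAlgClosed (IsLocalRing.ResidueField w.integer) := isAlgClosed_residueField_integer w
  obtain ⟨W₀, hW₀, hW₀1, hW₀2, hW₀3, hW₀4, hW₀6⟩ :=
    exists_integerModel_of_tateNormalForm hw J h1 h2 h3 h4 h6
  have hX : (J.baseChange Kᵥ).baseChange K̄ᵥ = W₀.baseChange K̄ᵥ := hW₀.symm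
  haveI : ((J.baseChange Kᵥ).baseChange K̄ᵥ).IsIntegral w.integer := ⟨⟨W₀, hX⟩⟩
  set e := WeierstrassCurve.Affine.Point.congrEquiv hX with he
  have hWres : W₀.map (residue w.integer) = singularModel 0 0 0 (-1) :=
    W₀.map_residue_eq_singularModel hW₀1 hW₀2 hW₀3 hW₀4 hW₀6
  have hne : (0 : IsLocalRing.ResidueField w.integer) ≠ -1 := zero_ne_neg_one_residueField
  obtain ⟨r, hr0, hr⟩ := W₀.exists_addMonoidHom_units_of_map_eq_singularModel hvw hWres hne
  have hrcongr : ∀ {A B : ((J.baseChange Kᵥ).baseChange K̄ᵥ).toAffine.Point}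
      (hA : W₀.HasNonsingularReduction (e A)) (hB : W₀.HasNonsingularReduction (e B)),
      A = B → r ⟨e A, hA⟩ = r ⟨e B, hB⟩ := by
    rintro A B hA hB rfl
    rfl
  -- `E₀`, `E₁` as predicates on `J(K̄_v)` and their basic properties
  have hE₀iff : ∀ T : ((J.baseChange Kᵥ).baseChange K̄ᵥ).toAffine.Point,
      ReducesToNonsingular w (residue w.integer) T ↔ W₀.HasNonsingularReduction (e T) := by
    intro T
    rw [← reducesToNonsingular_congrEquiv_iff (residue w.integer) hX T,
      reducesToNonsingular_iff_hasNonsingularReduction]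
  have hE₁some : ∀ {x y : K̄ᵥ} (h : ((J.baseChange Kᵥ).baseChange K̄ᵥ).toAffine.Nonsingular x y),
      W₀.ReducesToZero (e (.some x y h)) ↔ 1 < w x := by
    intro x y h
    rw [he, WeierstrassCurve.Affine.Point.congrEquiv_some, W₀.reducesToZero_some_iff_one_lt hvw]
  set E₀ : AddSubgroup ((J.baseChange Kᵥ).baseChange K̄ᵥ).toAffine.Point :=
    (W₀.nonsingularReductionSubgroup hvw).comap e.toAddMonoidHom with hE₀def
  have hmemE₀ : ∀ T, T ∈ E₀ ↔ W₀.HasNonsingularReduction (e T) := fun T ↦ by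
    rw [hE₀def, AddSubgroup.mem_comap]; rfl
  set E₁ : AddSubgroup ((J.baseChange Kᵥ).baseChange K̄ᵥ).toAffine.Point :=
    (W₀.kernelOfReduction hvw).comap e.toAddMonoidHom with hE₁def
  have hmemE₁ : ∀ T, T ∈ E₁ ↔ W₀.ReducesToZero (e T) := fun T ↦ by
    rw [hE₁def, AddSubgroup.mem_comap]; rfl
  have hE₁E₀ : E₁ ≤ E₀ := fun T hT ↦
    (hmemE₀ T).mpr (WeierstrassCurve.ReducesToZero.hasNonsingularReduction ((hmemE₁ T).mp hT))
  -- `E₁` has no prime-to-`p` torsion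
  have htors : ∀ {d : ℤ}, w (d : K̄ᵥ) = 1 → ∀ T ∈ E₁, d • T = 0 → T = 0 := by
    intro d hd T hT hdT
    have h0 : e T = 0 :=
      ((hmemE₁ T).mp hT).eq_zero_of_zsmul_eq_zero W₀ hd (by rw [← map_zsmul, hdT, map_zero])
    exact e.map_eq_zero_iff.mp h0
  -- `E₁` is divisible by prime-to-`p` integers
  have hdiv : ∀ {d : ℤ}, w (d : K̄ᵥ) = 1 → ∀ T ∈ E₁, ∃ T' ∈ E₁, d • T' = T := by
    intro d hd T hT
    rcases T with _ | ⟨x, y, h⟩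
    · exact ⟨0, E₁.zero_mem, (zsmul_zero _).trans rfl⟩
    · have hx : 1 < w x := (hE₁some h).mp ((hmemE₁ _).mp hT)
      obtain ⟨x', y', h', hx', hd'⟩ := exists_zsmul_eq_of_one_lt_val (w := w) hd h hx
      exact ⟨.some x' y' h', (hmemE₁ _).mpr ((hE₁some h').mpr hx'), hd'⟩
  /- (1) Galois: every `σ ∈ Γ` is an isometry; `E₀`, `E₁` are stable; `r(σ P) = σ̄ (r P)` -/
  have hiso : ∀ (σ : absoluteGaloisGroup Kᵥ) (z : K̄ᵥ),
      w (((absoluteGaloisGroup.toAlgEquiv Kᵥ σ : K̄ᵥ ≃ₐ[Kᵥ] K̄ᵥ) : K̄ᵥ →ₐ[Kᵥ] K̄ᵥ) z) = w z :=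
    fun σ z ↦ spectralValuation_smul hw σ z
  have hsmul : ∀ (σ : absoluteGaloisGroup Kᵥ) (T : ((J.baseChange Kᵥ).baseChange K̄ᵥ).toAffine.Point),
      absoluteGaloisGroup.toAlgEquiv Kᵥ σ • T =
        WeierstrassCurve.Affine.Point.map
          ((absoluteGaloisGroup.toAlgEquiv Kᵥ σ : K̄ᵥ ≃ₐ[Kᵥ] K̄ᵥ) : K̄ᵥ →ₐ[Kᵥ] K̄ᵥ) T :=
    fun σ T ↦ rfl
  have hgal : ∀ σ : absoluteGaloisGroup Kᵥ,
      ∃ σk : IsLocalRing.ResidueField w.integer →+* IsLocalRing.ResidueField w.integer,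
        (∀ (a : K̄ᵥ) (ha : w a ≤ 1) (hσa : w (absoluteGaloisGroup.toAlgEquiv Kᵥ σ a) ≤ 1),
          σk (residue w.integer ⟨a, ha⟩) =
            residue w.integer ⟨absoluteGaloisGroup.toAlgEquiv Kᵥ σ a, hσa⟩) ∧
        (∀ T, T ∈ E₀ → absoluteGaloisGroup.toAlgEquiv Kᵥ σ • T ∈ E₀) ∧
        ∀ (T : ((J.baseChange Kᵥ).baseChange K̄ᵥ).toAffine.Point)
          (hT : W₀.HasNonsingularReduction (e T))
          (hσT : W₀.HasNonsingularReduction (e (absoluteGaloisGroup.toAlgEquiv Kᵥ σ • T))),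
          ((r ⟨_, hσT⟩).toMul : IsLocalRing.ResidueField w.integer) =
            σk ((r ⟨_, hT⟩).toMul : IsLocalRing.ResidueField w.integer) := by
    intro σ
    obtain ⟨σk, hres, hstab, hx₀, -, hdisj⟩ :=
      W₀.exists_residueMap_nodeReduction_smul hX
        ((absoluteGaloisGroup.toAlgEquiv Kᵥ σ : K̄ᵥ ≃ₐ[Kᵥ] K̄ᵥ) : K̄ᵥ →ₐ[Kᵥ] K̄ᵥ) (hiso σ)
        hWres r hr0 hr
    refine ⟨σk, fun a ha hσa ↦ hres a ha hσa, fun T hT ↦ ?_, ?_⟩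
    · rw [hmemE₀] at hT ⊢
      exact hstab T hT
    · rcases hdisj with ⟨-, -, hequiv⟩ | ⟨h0, -, -⟩
      · intro T hT hσT
        exact hequiv T hT hσT
      · exfalso
        rw [map_zero] at h0
        exact hne h0
  have hE₁stab : ∀ (σ : absoluteGaloisGroup Kᵥ) (T), T ∈ E₁ →
      absoluteGaloisGroup.toAlgEquiv Kᵥ σ • T ∈ E₁ := by
    intro σ T hT
    rw [hmemE₁] at hT ⊢
    rw [hsmul, he]
    exact (W₀.reducesToZero_congrEquiv_map_iff hX _ (hiso σ) T).mpr hT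
  -- the Frobenius acts on residues by `x ↦ x^q`
  obtain ⟨σkF, hσkF, hE₀F, hrF⟩ := hgal F
  have hfrob : ∀ x : IsLocalRing.ResidueField w.integer, σkF x = x ^ qᵥ := by
    intro x
    obtain ⟨a, rfl⟩ := IsLocalRing.residue_surjective x
    have ha' : w (absoluteGaloisGroup.toAlgEquiv Kᵥ F (a : K̄ᵥ)) ≤ 1 := by
      rw [show absoluteGaloisGroup.toAlgEquiv Kᵥ F (a : K̄ᵥ) =
        ((absoluteGaloisGroup.toAlgEquiv Kᵥ F : K̄ᵥ ≃ₐ[Kᵥ] K̄ᵥ) : K̄ᵥ →ₐ[Kᵥ] K̄ᵥ) a from rfl, hiso]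
      exact a.2
    rw [show residue w.integer a = residue w.integer ⟨(a : K̄ᵥ), a.2⟩ from rfl, hσkF (a : K̄ᵥ) a.2 ha',
      residue_frobenius_smul_integer hw h𝔐 hF a ha']
  /- (2) the residue `s = r(S)` and its `e`-th root `t` -/
  have hS₀' : W₀.HasNonsingularReduction (e S) := (hE₀iff S).mp hS₀
  set s : IsLocalRing.ResidueField w.integer :=
    (((r ⟨e S, hS₀'⟩).toMul : (IsLocalRing.ResidueField w.integer)ˣ) : IsLocalRing.ResidueField w.integer) with hs
  have hs0 : s ≠ 0 := (r ⟨e S, hS₀'⟩).toMul.ne_zero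
  have hsq : s ^ qᵥ = s := by
    have hFS : W₀.HasNonsingularReduction (e (absoluteGaloisGroup.toAlgEquiv Kᵥ F • S)) := by
      rw [hS F]; exact hS₀'
    have h := hrF S hS₀' hFS
    rw [hfrob] at h
    rw [hs, ← h, hrcongr hFS hS₀' (hS F)]
  have hq1 : 1 < qᵥ := by
    haveI : Finite (IsLocalRing.ResidueField 𝓞ᵥ) := finite_residueField_adicCompletionIntegers K v
    exact Finite.one_lt_card
  set ex : ℕ := ∑ j ∈ Finset.range n, qᵥ ^ j with hex
  have hex0 : 0 < ex := by
    rw [hex]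
    exact Finset.sum_pos (fun j _ ↦ pow_pos (by omega) j) ⟨0, Finset.mem_range.mpr (Nat.pos_of_ne_zero hn)⟩
  obtain ⟨t, ht⟩ := IsAlgClosed.exists_pow_nat_eq s hex0
  have ht0 : t ≠ 0 := by
    rintro rfl
    rw [zero_pow hex0.ne'] at ht
    exact hs0 ht.symm
  have hm0 : qᵥ ^ n - 1 ≠ 0 := residueCard_pow_sub_one_ne_zero (v := v) hn
  have hmw : w ((qᵥ ^ n - 1 : ℕ) : K̄ᵥ) = 1 :=
    spectralValuation_natCast_residueCard_pow_sub_one hw hn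
  have ht1 : t ^ (qᵥ ^ n - 1) = 1 := by
    have hsq' : s ^ (qᵥ - 1) = 1 := by
      have h' : s ^ (qᵥ - 1) * s = 1 * s := by
        rw [← pow_succ, Nat.sub_add_cancel hq1.le, hsq, one_mul]
      exact mul_right_cancel₀ hs0 h'
    rw [← geom_sum_mul_of_one_le hq1.le n, pow_mul, ← hex, ht, hsq']
  -- `t` is the residue of a power `η` of `ζ`, which is fixed by the stabiliser of `ζ`
  have hζ1 : w ζ ≤ 1 := (val_eq_one_of_pow_eq_one w hm0 hζ.pow_eq_one).le
  obtain ⟨i, hi⟩ := exists_residue_pow_eq_of_pow_eq_one hw hn hζ hζ1 ht1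
  set η : w.integer := ⟨ζ, hζ1⟩ ^ i with hη
  have hηfix : ∀ σ : absoluteGaloisGroup Kᵥ, σ • ζ = ζ →
      absoluteGaloisGroup.toAlgEquiv Kᵥ σ (η : K̄ᵥ) = η := by
    intro σ hσ
    rw [hη, SubmonoidClass.coe_pow, map_pow]
    exact congrArg (· ^ i) hσ
  have hσkt : ∀ σ : absoluteGaloisGroup Kᵥ, σ • ζ = ζ →
      ∀ σk : IsLocalRing.ResidueField w.integer →+* IsLocalRing.ResidueField w.integer,
        (∀ (a : K̄ᵥ) (ha : w a ≤ 1) (hσa : w (absoluteGaloisGroup.toAlgEquiv Kᵥ σ a) ≤ 1),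
          σk (residue w.integer ⟨a, ha⟩) =
            residue w.integer ⟨absoluteGaloisGroup.toAlgEquiv Kᵥ σ a, hσa⟩) → σk t = t := by
    intro σ hσ σk hσk
    have hηle : w (absoluteGaloisGroup.toAlgEquiv Kᵥ σ (η : K̄ᵥ)) ≤ 1 := by
      rw [hηfix σ hσ]; exact η.2
    rw [← hi, show residue w.integer η = residue w.integer ⟨(η : K̄ᵥ), η.2⟩ from rfl,
      hσk (η : K̄ᵥ) η.2 hηle]
    congr 1
    exact Subtype.ext (hηfix σ hσ)
  /- (3) a lift of `t` to `E₀`: the point of parameter `m = t/(1 - t)` on the reduced node -/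
  have hlift : ∃ T₁ : ((J.baseChange Kᵥ).baseChange K̄ᵥ).toAffine.Point,
      ∃ hT₁ : W₀.HasNonsingularReduction (e T₁),
        ((r ⟨e T₁, hT₁⟩).toMul : IsLocalRing.ResidueField w.integer) = t := by
    by_cases ht_one : t = 1
    · refine ⟨0, by rw [map_zero]; trivial, ?_⟩
      have : (⟨e 0, by rw [map_zero]; trivial⟩ : W₀.nonsingularReductionSubgroup hvw) = 0 :=
        Subtype.ext (map_zero e)
      rw [this, map_zero, ht_one]
      rfl
    · set m : IsLocalRing.ResidueField w.integer := t / (1 - t) with hm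
      have h1t : 1 - t ≠ 0 := sub_ne_zero.mpr (Ne.symm ht_one)
      have hm₁ : m ≠ 0 := div_ne_zero ht0 h1t
      have hm₂ : m ≠ -1 := by
        intro hcon
        rw [hm, div_eq_iff h1t] at hcon
        have : (1 : IsLocalRing.ResidueField w.integer) = 0 := by linear_combination hcon
        exact one_ne_zero this
      have hns₀ := singularModel.nonsingular_pt (0 : IsLocalRing.ResidueField w.integer) 0 0 (-1) hm₁ hm₂
      have hns : (W₀.map (residue w.integer)).toAffine.Nonsingular
          (singularModel.ptX 0 0 (-1) m) (singularModel.ptY 0 0 (-1) m) := by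
        rw [hWres]; exact hns₀
      obtain ⟨a, b, heq, ha, hb⟩ := W₀.exists_equation_residue_eq hns
      have hnsab : (W₀.map (residue w.integer)).toAffine.Nonsingular (residue w.integer a)
          (residue w.integer b) := by rw [ha, hb]; exact hns
      have hab := W₀.nonsingular_baseChange_of_nonsingular_residue (K := K̄ᵥ) heq hnsab
      have hP : W₀.HasNonsingularReduction (.some _ _ hab) :=
        (WeierstrassCurve.hasNonsingularReduction_some_algebraMap_iff hvw.hom_inj hab).mpr hnsab
      have hnsab' : (singularModel 0 0 0 (-1)).toAffine.Nonsingular (residue w.integer a)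
          (residue w.integer b) := by rw [← hWres]; exact hnsab
      refine ⟨e.symm (.some _ _ hab), by rw [AddEquiv.apply_symm_apply]; exact hP, ?_⟩
      have hval := hr a b hab hnsab' hP
      have key : ((r ⟨e (e.symm (.some _ _ hab)), by rw [AddEquiv.apply_symm_apply]; exact hP⟩).toMul :
          IsLocalRing.ResidueField w.integer) = ((r ⟨.some _ _ hab, hP⟩).toMul : _) := by
        congr 3
        exact Subtype.ext (e.apply_symm_apply _)
      rw [key, hval]
      have hpt : (WeierstrassCurve.Affine.Point.some _ _ hnsab' :
          (singularModel (0 : IsLocalRing.ResidueField w.integer) 0 0 (-1)).toAffine.Point) =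
            singularModel.pt m hm₁ hm₂ := by
        rw [singularModel.pt_def]
        exact singularModel.some_congr ha hb
      have hden : m + 1 ≠ 0 := fun h0 ↦ hm₂ (eq_neg_of_add_eq_zero_left h0)
      rw [hpt, singularModel.nodeFun_pt, sub_zero, sub_neg_eq_add, div_eq_iff hden, hm]
      field_simp
      ring
  obtain ⟨T₁, hT₁, hrT₁⟩ := hlift
  /- (4) a `(qⁿ - 1)`-torsion point `R₁ ∈ E₀` with `r(R₁) = t` -/
  set d : ℕ := qᵥ ^ n - 1 with hd
  have hdw : w ((d : ℤ) : K̄ᵥ) = 1 := by rw [Int.cast_natCast]; exact hmw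
  have hT₁E₀ : T₁ ∈ E₀ := (hmemE₀ T₁).mpr hT₁
  have hdT₁ : (d : ℤ) • T₁ ∈ E₁ := by
    rw [hmemE₁]
    have hmem : (d : ℤ) • T₁ ∈ E₀ := E₀.zsmul_mem hT₁E₀ _
    rw [hmemE₀] at hmem
    rw [← hr0 ⟨_, hmem⟩]
    have hsub : (⟨e ((d : ℤ) • T₁), hmem⟩ : W₀.nonsingularReductionSubgroup hvw) =
        (d : ℤ) • ⟨e T₁, hT₁⟩ := Subtype.ext (by
          change e ((d : ℤ) • T₁) = (d : ℤ) • e T₁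
          exact map_zsmul e _ _)
    rw [hsub, map_zsmul]
    apply Additive.toMul.injective
    apply Units.ext
    rw [toMul_zsmul, Units.val_zpow_eq_zpow_val, hrT₁, toMul_zero, Units.val_one, zpow_natCast, ht1]
  obtain ⟨Q, hQE₁, hQ⟩ := hdiv hdw _ hdT₁
  set R₁ := T₁ - Q with hR₁
  have hR₁E₀ : R₁ ∈ E₀ := E₀.sub_mem hT₁E₀ (hE₁E₀ hQE₁)
  have hR₁' : W₀.HasNonsingularReduction (e R₁) := (hmemE₀ R₁).mp hR₁E₀
  have hdR₁ : (d : ℤ) • R₁ = 0 := by rw [hR₁, zsmul_sub, hQ, sub_self]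
  -- `r` on `E₁` vanishes, so `r(R₁) = r(T₁) = t`
  have hrE₁ : ∀ (T) (hT : W₀.HasNonsingularReduction (e T)), T ∈ E₁ → r ⟨e T, hT⟩ = 0 :=
    fun T hT hT₁ ↦ (hr0 ⟨e T, hT⟩).mpr ((hmemE₁ T).mp hT₁)
  have hrsub : ∀ (A B) (hA : W₀.HasNonsingularReduction (e A)) (hB : W₀.HasNonsingularReduction (e B))
      (hAB : W₀.HasNonsingularReduction (e (A - B))),
      r ⟨e (A - B), hAB⟩ = r ⟨e A, hA⟩ - r ⟨e B, hB⟩ := by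
    intro A B hA hB hAB
    rw [← map_sub]
    congr 1
    exact Subtype.ext (map_sub e A B)
  have hrR₁ : ((r ⟨e R₁, hR₁'⟩).toMul : IsLocalRing.ResidueField w.integer) = t := by
    have hQ' : W₀.HasNonsingularReduction (e Q) := (hmemE₀ Q).mp (hE₁E₀ hQE₁)
    have h : r ⟨e R₁, hR₁'⟩ = r ⟨e T₁, hT₁⟩ - r ⟨e Q, hQ'⟩ := hrsub T₁ Q hT₁ hQ' hR₁'
    rw [hrE₁ Q hQ' hQE₁, sub_zero] at h
    rw [h, hrT₁]
  /- (5) `R₁` is fixed by the stabiliser of `ζ` -/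
  have hR₁fix : ∀ σ : absoluteGaloisGroup Kᵥ, σ • ζ = ζ →
      absoluteGaloisGroup.toAlgEquiv Kᵥ σ • R₁ = R₁ := by
    intro σ hσ
    obtain ⟨σk, hσk, hE₀σ, hrσ⟩ := hgal σ
    have hσR₁E₀ : absoluteGaloisGroup.toAlgEquiv Kᵥ σ • R₁ ∈ E₀ := hE₀σ R₁ hR₁E₀
    have hσR₁' : W₀.HasNonsingularReduction (e (absoluteGaloisGroup.toAlgEquiv Kᵥ σ • R₁)) :=
      (hmemE₀ _).mp hσR₁E₀
    -- same `r`-value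
    have hreq : r ⟨e (absoluteGaloisGroup.toAlgEquiv Kᵥ σ • R₁), hσR₁'⟩ = r ⟨e R₁, hR₁'⟩ := by
      apply Additive.toMul.injective
      apply Units.ext
      rw [hrσ R₁ hR₁' hσR₁', hrR₁, hσkt σ hσ σk hσk]
    -- the difference lies in `E₁` and is killed by `d`
    have hdiffE₀ : R₁ - absoluteGaloisGroup.toAlgEquiv Kᵥ σ • R₁ ∈ E₀ := E₀.sub_mem hR₁E₀ hσR₁E₀
    have hdiff' : W₀.HasNonsingularReduction (e (R₁ - absoluteGaloisGroup.toAlgEquiv Kᵥ σ • R₁)) :=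
      (hmemE₀ _).mp hdiffE₀
    have hdiffE₁ : R₁ - absoluteGaloisGroup.toAlgEquiv Kᵥ σ • R₁ ∈ E₁ := by
      rw [hmemE₁, ← hr0 ⟨_, hdiff'⟩, hrsub _ _ hR₁' hσR₁' hdiff', hreq, sub_self]
    have hzero := htors hdw _ hdiffE₁ (by rw [zsmul_sub, smul_comm, hdR₁, smul_zero, sub_self])
    exact (sub_eq_zero.mp hzero).symm
  /- (6) the norm of `R₁` -/
  have hFn : F ^ n • ζ = ζ := (frobenius_pow_smul_eq_self_iff hw h𝔐 hF hn hζ n).mpr (dvd_refl n)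
  -- `r(Fʲ R₁) = t^{qʲ}` and `Fʲ R₁ ∈ E₀`
  have hpowE₀ : ∀ j : ℕ, absoluteGaloisGroup.toAlgEquiv Kᵥ (F ^ j) • R₁ ∈ E₀ := by
    intro j
    induction j with
    | zero => rw [pow_zero, map_one, one_smul]; exact hR₁E₀
    | succ j ih => rw [pow_succ', map_mul, mul_smul]; exact hE₀F _ ih
  have hrpow : ∀ (j : ℕ)
      (h : W₀.HasNonsingularReduction (e (absoluteGaloisGroup.toAlgEquiv Kᵥ (F ^ j) • R₁))),
      ((r ⟨_, h⟩).toMul : IsLocalRing.ResidueField w.integer) = t ^ qᵥ ^ j := by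
    intro j
    induction j with
    | zero =>
      intro h
      rw [hrcongr h hR₁' (by rw [pow_zero, map_one, one_smul]), hrR₁, pow_zero, pow_one]
    | succ j ih =>
      intro h
      have hprev : W₀.HasNonsingularReduction (e (absoluteGaloisGroup.toAlgEquiv Kᵥ (F ^ j) • R₁)) :=
        (hmemE₀ _).mp (hpowE₀ j)
      have hmem : W₀.HasNonsingularReduction
          (e (absoluteGaloisGroup.toAlgEquiv Kᵥ F • (absoluteGaloisGroup.toAlgEquiv Kᵥ (F ^ j) • R₁))) :=
        (hmemE₀ _).mp (hE₀F _ (hpowE₀ j))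
      have hstep := hrF _ hprev hmem
      rw [hrcongr h hmem (by rw [pow_succ', map_mul, mul_smul]), hstep, hfrob, ih hprev, ← pow_mul,
        ← pow_succ]
  set N : ((J.baseChange Kᵥ).baseChange K̄ᵥ).toAffine.Point →
      ((J.baseChange Kᵥ).baseChange K̄ᵥ).toAffine.Point :=
    fun T ↦ ∑ j ∈ Finset.range n, absoluteGaloisGroup.toAlgEquiv Kᵥ (F ^ j) • T with hN
  have hNadd : ∀ A B, N (A + B) = N A + N B := fun A B ↦ by
    simp only [hN, smul_add, Finset.sum_add_distrib]
  have hNsub : ∀ A B, N (A - B) = N A - N B := fun A B ↦ by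
    simp only [hN, smul_sub, Finset.sum_sub_distrib]
  have hNR₁E₀ : N R₁ ∈ E₀ := E₀.sum_mem fun j _ ↦ hpowE₀ j
  have hNR₁' : W₀.HasNonsingularReduction (e (N R₁)) := (hmemE₀ _).mp hNR₁E₀
  have hrN : ((r ⟨e (N R₁), hNR₁'⟩).toMul : IsLocalRing.ResidueField w.integer) = s := by
    set u : ℕ → W₀.nonsingularReductionSubgroup hvw :=
      fun j ↦ ⟨e (absoluteGaloisGroup.toAlgEquiv Kᵥ (F ^ j) • R₁), (hmemE₀ _).mp (hpowE₀ j)⟩ with hu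
    have hsum : (⟨e (N R₁), hNR₁'⟩ : W₀.nonsingularReductionSubgroup hvw) = ∑ j ∈ Finset.range n, u j := by
      apply Subtype.ext
      rw [AddSubgroup.val_finsetSum]
      change e (∑ j ∈ Finset.range n, absoluteGaloisGroup.toAlgEquiv Kᵥ (F ^ j) • R₁) =
        ∑ j ∈ Finset.range n, e (absoluteGaloisGroup.toAlgEquiv Kᵥ (F ^ j) • R₁)
      exact map_sum e _ _
    rw [hsum, map_sum, toMul_sum, Units.coe_prod]
    rw [Finset.prod_congr rfl fun j _ ↦ hrpow j ((hmemE₀ _).mp (hpowE₀ j)), Finset.prod_pow_eq_pow_sum,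
      ← hex, ht]
  -- `N R₁` is fixed by `F` and by the stabiliser of `ζ`
  have hNfixF : absoluteGaloisGroup.toAlgEquiv Kᵥ F • N R₁ = N R₁ := by
    have hshift : ∀ j, absoluteGaloisGroup.toAlgEquiv Kᵥ F • (absoluteGaloisGroup.toAlgEquiv Kᵥ (F ^ j) • R₁) =
        absoluteGaloisGroup.toAlgEquiv Kᵥ (F ^ (j + 1)) • R₁ := fun j ↦ by
      rw [pow_succ', map_mul, mul_smul]
    have hlast : absoluteGaloisGroup.toAlgEquiv Kᵥ (F ^ n) • R₁ = R₁ := hR₁fix (F ^ n) hFn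
    rw [hN]
    change absoluteGaloisGroup.toAlgEquiv Kᵥ F • ∑ j ∈ Finset.range n, absoluteGaloisGroup.toAlgEquiv Kᵥ (F ^ j) • R₁ =
      ∑ j ∈ Finset.range n, absoluteGaloisGroup.toAlgEquiv Kᵥ (F ^ j) • R₁
    rw [Finset.smul_sum, Finset.sum_congr rfl fun j _ ↦ hshift j]
    have e1 := Finset.sum_range_succ' (fun j ↦ absoluteGaloisGroup.toAlgEquiv Kᵥ (F ^ j) • R₁) n
    have e2 := Finset.sum_range_succ (fun j ↦ absoluteGaloisGroup.toAlgEquiv Kᵥ (F ^ j) • R₁) n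
    rw [hlast] at e2
    rw [pow_zero, map_one, one_smul] at e1
    exact add_right_cancel (e1.symm.trans e2)
  have hNfixτ : ∀ τ : absoluteGaloisGroup Kᵥ, τ • ζ = ζ →
      absoluteGaloisGroup.toAlgEquiv Kᵥ τ • N R₁ = N R₁ := by
    intro τ hτ
    rw [hN]
    change absoluteGaloisGroup.toAlgEquiv Kᵥ τ • ∑ j ∈ Finset.range n, absoluteGaloisGroup.toAlgEquiv Kᵥ (F ^ j) • R₁ =
      ∑ j ∈ Finset.range n, absoluteGaloisGroup.toAlgEquiv Kᵥ (F ^ j) • R₁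
    rw [Finset.smul_sum]
    refine Finset.sum_congr rfl fun j _ ↦ ?_
    have hconj := hR₁fix ((F ^ j)⁻¹ * τ * F ^ j) (frobenius_pow_inv_mul_mul_smul_eq hw h𝔐 hF hn hζ hτ j)
    conv_rhs => rw [← hconj]
    rw [← mul_smul, ← mul_smul, ← map_mul, ← map_mul]
    congr 2
    group
  /- (7) the defect `D = S - N R₁ ∈ E₁`, its `n`-th root `D'`, and `R₀ = R₁ + D'` -/
  set D := S - N R₁ with hD
  have hSE₀ : S ∈ E₀ := (hmemE₀ S).mpr hS₀'
  have hDE₀ : D ∈ E₀ := E₀.sub_mem hSE₀ hNR₁E₀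
  have hD' : W₀.HasNonsingularReduction (e D) := (hmemE₀ D).mp hDE₀
  have hDE₁ : D ∈ E₁ := by
    rw [hmemE₁, ← hr0 ⟨_, hD'⟩, hrsub _ _ hS₀' hNR₁' hD']
    apply sub_eq_zero.mpr
    apply Additive.toMul.injective
    apply Units.ext
    rw [hrN]
  have hDfixF : absoluteGaloisGroup.toAlgEquiv Kᵥ F • D = D := by rw [hD, smul_sub, hS F, hNfixF]
  have hDfixτ : ∀ τ : absoluteGaloisGroup Kᵥ, τ • ζ = ζ → absoluteGaloisGroup.toAlgEquiv Kᵥ τ • D = D :=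
    fun τ hτ ↦ by rw [hD, smul_sub, hS τ, hNfixτ τ hτ]
  have hnw' : w ((n : ℤ) : K̄ᵥ) = 1 := by rw [Int.cast_natCast]; exact hnw
  obtain ⟨D', hD'E₁, hnD'⟩ := hdiv hnw' D hDE₁
  -- uniqueness of `D'` makes it fixed by everything fixing `D`
  have hD'fix : ∀ σ : absoluteGaloisGroup Kᵥ, absoluteGaloisGroup.toAlgEquiv Kᵥ σ • D = D →
      absoluteGaloisGroup.toAlgEquiv Kᵥ σ • D' = D' := by
    intro σ hσD
    have hmem : absoluteGaloisGroup.toAlgEquiv Kᵥ σ • D' - D' ∈ E₁ := E₁.sub_mem (hE₁stab σ D' hD'E₁) hD'E₁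
    have hkill : (n : ℤ) • (absoluteGaloisGroup.toAlgEquiv Kᵥ σ • D' - D') = 0 := by
      rw [zsmul_sub, smul_comm, hnD', hσD, sub_self]
    exact sub_eq_zero.mp (htors hnw' _ hmem hkill)
  have hND' : N D' = D := by
    have hfixj : ∀ j : ℕ, absoluteGaloisGroup.toAlgEquiv Kᵥ (F ^ j) • D' = D' := by
      intro j
      induction j with
      | zero => rw [pow_zero, map_one, one_smul]
      | succ j ih => rw [pow_succ', map_mul, mul_smul, ih, hD'fix F hDfixF]
    rw [hN]
    change ∑ j ∈ Finset.range n, absoluteGaloisGroup.toAlgEquiv Kᵥ (F ^ j) • D' = D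
    rw [Finset.sum_congr rfl fun j _ ↦ hfixj j, Finset.sum_const, Finset.card_range, ← hnD',
      natCast_zsmul]
  refine ⟨R₁ + D', ?_, fun σ hσ ↦ ?_, ?_⟩
  · exact (hE₀iff _).mpr ((hmemE₀ _).mp (E₀.add_mem hR₁E₀ (hE₁E₀ hD'E₁)))
  · rw [smul_add, hR₁fix σ hσ, hD'fix σ (hDfixτ σ hσ)]
  · change N (R₁ + D') = S
    rw [hNadd, hND', hD, add_sub_cancel]

include hw in
/-- **`E₀ ⊆ J(K̄_v)` as a `Γ_{K_v}`-stable subgroup** (consumer form): for `X = J ⊗ K_v` with `J` a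
Tate normal form there is a subgroup `E₀` of `X(K̄_v)` whose members are exactly the points with
nonsingular reduction for `|·|_v` (`ReducesToNonsingular`; Silverman, *AEC*, Prop. VII.2.1:
`E₀` is a subgroup), stable under `Γ_{K_v}` (every `σ` is a `|·|_v`-isometry). [cite: SilvermanAEC2009, VII.2 Prop. 2.1] -/
theorem exists_addSubgroup_reducesToNonsingular_of_eq_tateNormalForm (J : WeierstrassCurve 𝓞ᵥ)
    (h1 : J.a₁ = 1) (h2 : J.a₂ = 0) (h3 : J.a₃ = 0) (h4 : J.a₄ = 0)
    (h6 : J.a₆ ∈ maximalIdeal 𝓞ᵥ) (X : WeierstrassCurve Kᵥ) (hXJ : X = J.baseChange Kᵥ) :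
    ∃ E₀ : AddSubgroup (X.baseChange K̄ᵥ).toAffine.Point,
      (∀ P, P ∈ E₀ ↔ ReducesToNonsingular w (residue w.integer) P) ∧
      ∀ (σ : absoluteGaloisGroup Kᵥ) (P), P ∈ E₀ → absoluteGaloisGroup.toAlgEquiv Kᵥ σ • P ∈ E₀ := by
  subst hXJ
  have hvw : w.Integers w.integer := Valuation.integer.integers w
  obtain ⟨W₀, hW₀, hW₀1, hW₀2, hW₀3, hW₀4, hW₀6⟩ :=
    exists_integerModel_of_tateNormalForm hw J h1 h2 h3 h4 h6
  have hX : (J.baseChange Kᵥ).baseChange K̄ᵥ = W₀.baseChange K̄ᵥ := hW₀.symm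
  set e := WeierstrassCurve.Affine.Point.congrEquiv hX with he
  refine ⟨(W₀.nonsingularReductionSubgroup hvw).comap e.toAddMonoidHom, fun P ↦ ?_, fun σ P hP ↦ ?_⟩
  · rw [AddSubgroup.mem_comap, ← reducesToNonsingular_congrEquiv_iff (residue w.integer) hX P,
      reducesToNonsingular_iff_hasNonsingularReduction]
    rfl
  · rw [AddSubgroup.mem_comap] at hP ⊢
    change W₀.HasNonsingularReduction (e (WeierstrassCurve.Affine.Point.map _ P))
    rcases P with _ | ⟨x, y, h⟩
    · rw [← WeierstrassCurve.Affine.Point.zero_def, map_zero, map_zero]; trivial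
    · change W₀.HasNonsingularReduction (e (.some _ _ _)) at hP
      rw [he, WeierstrassCurve.Affine.Point.congrEquiv_some,
        W₀.hasNonsingularReduction_some_iff_one_le hvw hW₀1 hW₀2 hW₀3 hW₀4 hW₀6] at hP
      rw [WeierstrassCurve.Affine.Point.map_some, he, WeierstrassCurve.Affine.Point.congrEquiv_some,
        W₀.hasNonsingularReduction_some_iff_one_le hvw hW₀1 hW₀2 hW₀3 hW₀4 hW₀6]
      exact (spectralValuation_smul hw σ x).symm ▸ hP

include hw in
/-- `exists_norm_eq_of_tateNormalForm` for an equation `X` over `K_v` with `X = J ⊗ K_v`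
(consumer form). [cite: Matsuno2009, Lemma 4.1 (proof, p. 454, display (4))] -/
theorem exists_norm_eq_of_eq_tateNormalForm (J : WeierstrassCurve 𝓞ᵥ)
    (h1 : J.a₁ = 1) (h2 : J.a₂ = 0) (h3 : J.a₃ = 0) (h4 : J.a₄ = 0)
    (h6 : J.a₆ ∈ maximalIdeal 𝓞ᵥ)
    {𝔐 : Ideal v.localAbsIntegers} (h𝔐 : 𝔐 ∈ v.localPrimesAbove)
    {F : absoluteGaloisGroup Kᵥ} (hF : IsArithFrobAt 𝓞ᵥ F 𝔐)
    {n : ℕ} (hn : n ≠ 0) (hnw : w (n : K̄ᵥ) = 1)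
    {ζ : K̄ᵥ} (hζ : IsPrimitiveRoot ζ (qᵥ ^ n - 1))
    (X : WeierstrassCurve Kᵥ) [X.IsElliptic] (hXJ : X = J.baseChange Kᵥ)
    (S : (X.baseChange K̄ᵥ).toAffine.Point)
    (hS : ∀ σ : absoluteGaloisGroup Kᵥ, absoluteGaloisGroup.toAlgEquiv Kᵥ σ • S = S)
    (hS₀ : ReducesToNonsingular w (residue w.integer) S) :
    ∃ R₀ : (X.baseChange K̄ᵥ).toAffine.Point,
      ReducesToNonsingular w (residue w.integer) R₀ ∧
      (∀ σ : absoluteGaloisGroup Kᵥ, σ • ζ = ζ → absoluteGaloisGroup.toAlgEquiv Kᵥ σ • R₀ = R₀) ∧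
      ∑ j ∈ Finset.range n, absoluteGaloisGroup.toAlgEquiv Kᵥ (F ^ j) • R₀ = S := by
  subst hXJ
  exact exists_norm_eq_of_tateNormalForm hw J h1 h2 h3 h4 h6 h𝔐 hF hn hnw hζ S hS hS₀

end IsDedekindDomain.HeightOneSpectrum

end
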